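import Summits.RiemannHypothesis.RiemannHypothesis.Theorems.WeilFormatCDataKitCB
import Summits.RiemannHypothesis.RiemannHypothesis.Theorems.WeilFormatCFarDiagPos
import HarnessLib

/-!
# Format C, design C∞: FLOORS of the table door in the EMITTER'S data shape (middle list + separate far value)

Route context: Fourier–Galerkin / Schur-complement certificates of Weil positivity on a window ("format C", C∞ door;
cell memo `run/shared/lean/pub/rh-explicit/rh-explicit-weil-10/KERNEL-LEVER.md` §24; supporting stmt-RiemannHypothesis-0098;
seat rh-explicit-weil-10).  `weilPositivityOn_of_cinf_tableG / _pipeline` take per sector a middle-weight table `wtab` on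
`[Be+1, m₀e)` (resp. kernel indices `[Bo, m₀o)`) with `d₀ ≤ wtab m ≤ d̂_A(m)`, `0 < d₀ ≤ d₁`, and a far value `d₁` below
`d̂_A` from `m₀` on.  rh-explicit-weil-2's exact stage pipeline (EMITTER-PHASE2 §1.6) fixes the data shape: the reciprocal
weights `VW` (`w(B+t) = 2^{cv}/VW_t`, exactly `Nm = m₀ − B` entries, the list its stage `T` reads) and ONE reciprocal far value
`d₁ = 2^{cv}/E1`.  This file supplies the door's floor hypotheses from exactly these two objects and the format-C light table:

* `tabColValid_merge` — a FULL table valid below `N₁` and a LIGHT table valid on `[N₁, N₂)` merge into one light table on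
  `[0, N₂)` (the C∞ ranges start below the K-rungs' block size, where only the full table has records);
* `cinf_far_floor_odd_of_devOdd0A` — the generic odd far floor `hfaro` from the single `π/4` check at `m₀o`;
* `cinf_floors_even_split` — even: `checkWeightsEvenV` on the middle list (`Nm` entries) + the plain far inequality
  `2^{cv}·S ≤ E1·devEvenBox(m₀e).lo`; conclusion `0 < d₀ ∧ d₀ ≤ d₁ ∧ htabe ∧ hd₁e` with `d₀ = 2^{cv}/vmax`, `d₁ = 2^{cv}/E1`;
* `cinf_floors_odd_split` — odd: `checkWeightsOddV` (arctan boxes) on the middle list + `2^{cv}·S ≤ E1·devOddBox(m₀o).lo`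
  (`π/4` box); conclusion `0 < d₀ ∧ d₀ ≤ d₁ ∧ htabo ∧ hfaro`.

Interval plumbing only; standard axioms; no definitions; no RH claim.
-/

set_option linter.dupNamespace false
set_option autoImplicit false

noncomputable section

open Complex Finset
open scoped Real BigOperators ArithmeticFunction.vonMangoldt

namespace Summit.RiemannHypothesis.RiemannHypothesis.Theorems.WeilFormatC

open Literature.NumberTheory.LFunctions Literature.NumberTheory.LFunctions.Yoshida1992
  Literature.NumberTheory.LFunctions.Yoshida1992.Encl Literature.Analysis.SpecialFunctions
  Literature.Analysis.ValidatedNumerics.NumericsMP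

variable {a : ℝ} {S : ℕ} {ks : List PrimeLen} {C : Consts} {F : FDConsts}

/-! ## Merging the K-rung tables into one light table -/

/-- Entries of a table built by `List.range … |>.map`. -/
theorem tget_range_map (f : ℕ → IdxRec) {N m : ℕ} (hm : m < N) : tget ((List.range N).map f) m = f m := by
  unfold tget
  rw [List.getD_eq_getElem?_getD, List.getElem?_map, List.getElem?_range hm, Option.map_some, Option.getD_some]

/-- **Merge**: a full table valid below `N₁` and a light table valid on `[N₁, N₂)` give ONE light table valid on `[0, N₂)`. -/
theorem tabColValid_merge {tab ctab : List IdxRec} {N₁ N₂ : ℕ} (hT : TabValid S a ks N₁ tab)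
    (hC : TabColValid S a ks N₁ N₂ ctab) :
    TabColValid S a ks 0 N₂ ((List.range N₂).map fun m ↦ if m < N₁ then tget tab m else tget ctab m) := by
  intro m _ hm
  rw [tget_range_map _ hm]
  by_cases h : m < N₁
  · rw [if_pos h]
    exact ⟨(hT m h).1, (hT m h).2.reP⟩
  · rw [if_neg h]
    exact hC m (by omega) hm

/-- Restricting a light table's validity range. -/
theorem TabColValid.mono {lo hi lo' hi' : ℕ} {ctab : List IdxRec} (h : TabColValid S a ks lo hi ctab) (hlo : lo ≤ lo')
    (hhi : hi' ≤ hi) : TabColValid S a ks lo' hi' ctab :=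
  fun m hm hm' ↦ h m (by omega) (by omega)

/-! ## The odd far floor from the `π/4` check -/

/-- **`hfaro` from the `π/4` check.**  `d₁ ≤ devOdd0A a A Bo m₀o` (core at `m₀o` minus `π/4` minus constants) gives
`d₁ ≤ devOddAA a A Bo k` for every `k ≥ m₀o` (monotone core, arctan penalty `≤ π/4`). -/
theorem cinf_far_floor_odd_of_devOdd0A (ha : 0 < a) (A : ℝ) {Bo m₀o : ℕ} {d₁ : ℝ}
    (hd₁ : d₁ ≤ devOdd0A a A Bo m₀o) : ∀ k : ℕ, m₀o ≤ k → d₁ ≤ devOddAA a A Bo k := by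
  intro k hk
  have hC : 0 ≤ a * (1 + weilArchDensity (2 * a)) := by
    have := weilArchDensity_pos (t := 2 * a) (by positivity)
    positivity
  have hmono := odd_dhat_core_mono ha hC (B := m₀o) (k := k) hk
  have hpen := hilbert_atan_penalty_le Bo k
  unfold devOdd0A at hd₁
  unfold devOddAA
  linarith

/-! ## Floors in the emitter's shape -/

/-- Antitone reciprocal weights. -/
private theorem recip_le {cv x y : ℕ} (hx : 0 < x) (hxy : x ≤ y) : (2 : ℝ) ^ cv / y ≤ (2 : ℝ) ^ cv / x :=
  div_le_div_of_nonneg_left (by positivity) (by exact_mod_cast hx) (by exact_mod_cast hxy)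

/-- **Even floors, emitter shape.**  Block modes `0..Be` (far from `Be+1`), threshold `m₀e`, light records valid on
`[Be+1, N)` with `m₀e < N`; the middle list `v` (`m₀e − (Be+1)` entries, `w(m) = 2^{cv}/v_{m−Be−1}`) is checked by
`checkWeightsEvenV`; the far value `d₁ = 2^{cv}/v₁` by ONE inequality against `devEvenBox` at `m₀e`; `d₀ = 2^{cv}/vmax` for any
bound `vmax` of the list and of `v₁`.  Conclusion: `0 < d₀`, `d₀ ≤ d₁`, the door's `htabe` for `wtabe := wvF v cv (Be+1)`, and
`hd₁e` — up to unfolding `devEvenA` (definitional). -/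
theorem cinf_floors_even_split (hS : 0 < S) (ha : 0 < a) {A : ℝ} (hC : ConstsValid S a ks C) (hF : FDValidA S a A F)
    {ctab : List IdxRec} {Be m₀e N : ℕ} (hBm : Be + 1 ≤ m₀e) (hN : m₀e < N)
    (hCT : TabColValid S a ks (Be + 1) N ctab)
    {p q : ℕ} (hsq : checkSqrtUpper 8 (Be + 1 - 1) p q = true)
    {cv : ℕ} {v : List ℕ} (hW : checkWeightsEvenV S C F ctab (Be + 1) (m₀e - (Be + 1)) cv v p q = true)
    {v₁ : ℕ} (hv₁ : 0 < v₁)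
    (hfar : (2 ^ cv : ℤ) * (S : ℤ) ≤ (v₁ : ℤ) * (devEvenBox S C F (tget ctab m₀e) m₀e p q).lo)
    {vmax : ℕ} (hvmax : ∀ t, t < m₀e - (Be + 1) → v.getD t 0 ≤ vmax) (hv₁max : v₁ ≤ vmax) :
    0 < (2 : ℝ) ^ cv / vmax ∧ (2 : ℝ) ^ cv / vmax ≤ (2 : ℝ) ^ cv / v₁ ∧
    (∀ m : ℕ, Be + 1 ≤ m → m < m₀e →
      (2 : ℝ) ^ cv / vmax ≤ wvF v cv (Be + 1) m ∧ wvF v cv (Be + 1) m ≤ devEvenA a A (Be + 1) m) ∧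
    (2 : ℝ) ^ cv / v₁ ≤ devEvenA a A (Be + 1) m₀e := by
  have hvmax0 : 0 < vmax := lt_of_lt_of_le hv₁ hv₁max
  have hvr : (0 : ℝ) < vmax := by exact_mod_cast hvmax0
  refine ⟨by positivity, recip_le hv₁ hv₁max, fun m hm hmm ↦ ?_, ?_⟩
  · obtain ⟨hvpos, hvle⟩ := weightsEvenV_of_check hW (m - (Be + 1)) (by omega)
    rw [show Be + 1 + (m - (Be + 1)) = m by omega] at hvle
    have hre : MI.mem S (reDigammaQuarter (freq a m)) (tget ctab m).reP := (hCT m hm (by omega)).2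
    have hlo := devEvenBox_lo_le_A hS ha hC hF hre (by omega) hsq (Be := Be + 1) (p := p) (q := q)
    have hw := wv_le_of_lo hS hvpos hvle hlo
    refine ⟨?_, by simpa only [wvF] using hw.2⟩
    unfold wvF
    exact recip_le hvpos (hvmax _ (by omega))
  · have hre : MI.mem S (reDigammaQuarter (freq a m₀e)) (tget ctab m₀e).reP := (hCT m₀e (by omega) hN).2
    have hlo := devEvenBox_lo_le_A hS ha hC hF hre (by omega) hsq (Be := Be + 1) (p := p) (q := q)
    exact (wv_le_of_lo hS hv₁ hfar hlo).2

/-- **Odd floors, emitter shape, `π/4` far value.**  Block = kernel indices `0..Bo−1` (modes `1..Bo`), far indices `k ≥ Bo`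
(mode `k+1`), threshold index `m₀o`; light records valid at the MODES `[Bo+1, N)` with `m₀o + 1 < N`; the middle list `v`
(`m₀o − Bo` entries) is checked by `checkWeightsOddV` against the arctan boxes; the far value `d₁ = 2^{cv}/v₁` by ONE inequality
against the `π/4` box `devOddBox` at `m₀o`; `d₀ = 2^{cv}/vmax`.  Conclusion: `0 < d₀`, `d₀ ≤ d₁`, the door's `htabo` for
`wtabo := wvF v cv Bo`, and the generic far floor `hfaro` (`∀ k ≥ m₀o, d₁ ≤ devOddAA a A Bo k`). -/
theorem cinf_floors_odd_split (hS : 0 < S) (ha : 0 < a) {A : ℝ} (hC : ConstsValid S a ks C) (hF : FDValidA S a A F)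
    {ctab : List IdxRec} {Bo m₀o N : ℕ} (hBo : 0 < Bo) (hBm : Bo ≤ m₀o) (hN : m₀o + 1 < N)
    (hCT : TabColValid S a ks (Bo + 1) N ctab)
    {Kser q p q' : ℕ} (hsq : checkSqrtUpper 8 Bo p q' = true)
    {cv : ℕ} {v rs : List ℕ} (hW : checkWeightsOddV S Kser C F ctab Bo (m₀o - Bo) cv v rs q p q' = true)
    {v₁ : ℕ} (hv₁ : 0 < v₁)
    (hfar : (2 ^ cv : ℤ) * (S : ℤ) ≤ (v₁ : ℤ) * (devOddBox S C F (tget ctab (m₀o + 1)) m₀o Bo p q').lo)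
    {vmax : ℕ} (hvmax : ∀ t, t < m₀o - Bo → v.getD t 0 ≤ vmax) (hv₁max : v₁ ≤ vmax) :
    0 < (2 : ℝ) ^ cv / vmax ∧ (2 : ℝ) ^ cv / vmax ≤ (2 : ℝ) ^ cv / v₁ ∧
    (∀ k : ℕ, Bo ≤ k → k < m₀o →
      (2 : ℝ) ^ cv / vmax ≤ wvF v cv Bo k ∧ wvF v cv Bo k ≤ devOddAA a A Bo k) ∧
    (∀ k : ℕ, m₀o ≤ k → (2 : ℝ) ^ cv / v₁ ≤ devOddAA a A Bo k) := by
  have hvmax0 : 0 < vmax := lt_of_lt_of_le hv₁ hv₁max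
  have hvr : (0 : ℝ) < vmax := by exact_mod_cast hvmax0
  refine ⟨by positivity, recip_le hv₁ hv₁max, fun k hk hkm ↦ ?_, ?_⟩
  · obtain ⟨hvpos, hsqk, Y, hY, hvle⟩ := weightsOddV_of_check hW (k - Bo) (by omega)
    rw [show Bo + (k - Bo) = k by omega] at hsqk hY
    have hre : MI.mem S (reDigammaQuarter (freq a ((k : ℤ) + 1))) (tget ctab (k + 1)).reP := by
      have h := (hCT (k + 1) (by omega) (by omega)).2
      push_cast at h
      exact h
    have hlo := devOddABox_lo_le_A hS ha hC hF hre hBo hsqk hsq hY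
    have hw := wv_le_of_lo hS hvpos hvle hlo
    refine ⟨?_, by simpa only [wvF] using hw.2⟩
    unfold wvF
    exact recip_le hvpos (hvmax _ (by omega))
  · have hre : MI.mem S (reDigammaQuarter (freq a ((m₀o : ℤ) + 1))) (tget ctab (m₀o + 1)).reP := by
      have h := (hCT (m₀o + 1) (by omega) hN).2
      push_cast at h
      exact h
    have hlo := devOddBox_lo_le_A hS ha hC hF hre hBo hsq (l := m₀o) (p := p) (q := q')
    exact cinf_far_floor_odd_of_devOdd0A ha A (wv_le_of_lo hS hv₁ hfar hlo).2

end Summit.RiemannHypothesis.RiemannHypothesis.Theorems.WeilFormatC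

end
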